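import Mathlib
import Literature.NumberTheory.LFunctions.Zhang2022.Section14Eq143TailBounds
import Literature.NumberTheory.LFunctions.Zhang2022.Section14Eq143Shift
import Literature.NumberTheory.LFunctions.Zhang2022.Section7I1LineBounds
import Literature.NumberTheory.Sieve.LargeSieveCharacters
import HarnessLib

/-!
# Zhang (2022) §14 u004 (p. 76, tex L3858): the integrand of `Ĩ₂(ψ)` on the line `σ = 3/2` — size,
# continuity, integrability (tools for `Z22:§14.u004`), kernel-checked

Topic `Literature/NumberTheory/LFunctions/Zhang2022` (Landau–Siegel audit tree; verdict-neutral).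
Y. Zhang, *Discrete mean estimates and the Landau–Siegel zero*, arXiv:2211.02515v1 (2022)
[Zhang2022LandauSiegel] — **an unrefereed manuscript under adjudication; nothing here asserts or
denies its Theorems 1–2.** ZHANG-L discharge lane (WP14); THEOREM-ONLY (no definition, no named fact).

§14 p. 76 (tex L3858), proof of Proposition 14.1, the step `Z22:§14.u004`:

> We use (2.5) with `θ = ψχ` and then replace the segment `𝔍(1)` by the vertical line `σ = 3/2`
> with a negligible error. Thus, by integration term by term,
> `Ĩ₂(ψ) = τ(χψ̄)/(Dp) Σ_m Σ_n κ*(m)a*(n)ψ(m)ψ̄(n)/n · Δ₁(m/(Dpn)) + O(ε)`.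

This is the §14 twin of the §7 step `Z22:§7.u021`/`u022` (PROVED in the tree: `Section7I1Line`,
`Section7I1LineBounds`, `Section7I1Termwise`), with the primitive character `ψχ (mod Dp)` in place of
`ψ (mod p)`, the `m`-series `Σ_m κ*(m)ψ(m)m^{−s}` under (14.1) `κ* ≪ τ₅` and the `a*`-polynomial
`Σ_{n≤2P₄} a*(n)ψ̄(n)n^{s−1}` under (14.2). This file supplies, for the MODIFIED integrand
`G(s) = τ((ψχ)‾)(Dp)^{s−1}ϑ*(1−s)·(Σ_m κ*(m)ψ(m)m^{−s})·(Σ_n a*(n)ψ̄(n)n^{s−1})·ω(s)` on `s = 3/2 + it`,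
its size ("a trivial bound for `ϑ*(1−s)ω(s)` on `σ = 3/2`"), continuity and integrability; the companion
`Section14U004Line` replaces the segment by the line and `Section14U004Termwise` integrates term by term.

| decl | content |
|---|---|
| `tsum_twist_eq_LSeries`, `continuous_twist_line`, `norm_twist_tsum_le` | the `m`-series on `σ = 3/2`: an `LSeries` (tree `Eq143.tsum_twist_eq_head_add_LSeries`), continuous, `≤ B·Σ_m τ₅(m)m^{−3/2}` |
| `continuous_apoly_line` | continuity of the `a*`-polynomial along the line |
| `continuous_lineIntegrand` | continuity of `t ↦ G(3/2+it)` |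
| `norm_lineIntegrand_le` | `‖G(3/2+it)‖ ≤ K·(1+|t|)²·exp((1−(t−2πt₀)²)/(4𝓛₂²))`, `K = 16π²S·B²·(Dp)·⌊2P₄⌋^{3/2}·(√π/𝓛₂)`, `S = Σ_m τ₅(m)m^{−3/2}` |
| `norm_lineIntegrand_le_gauss` | `‖G(3/2+it)‖ ≤ K·e·144𝓛¹⁰³⁸·e^{−(t−2πt₀)²/(8𝓛₂²)}` (`D ≥ 9`; tree `Section7I1Line.poly_gauss_le`) |
| `integrable_lineIntegrand` | `t ↦ G(3/2+it)` is integrable on `ℝ` (`D ≥ 9`) |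

No fact beyond Mathlib and tree theorems is used (`|τ(θ)|² = Dp` for the primitive `θ = ψχ`:
`Sieve.LargeSieve.norm_gaussSum_sq`, `Skeleton.psiChiPrimitive_holds`; Γ-bounds via
`Section7I1Line.norm_varthetaStar_le`).

## References

* Y. Zhang, arXiv:2211.02515v1 (2022), §14 p. 76, tex L3854–L3858; §7 p. 35, tex L1920; §2 (2.5),
  (2.15); §5 (5.5)–(5.6). [cite: Zhang2022LandauSiegel, §14 u004 p.76]
-/

noncomputable section

open Complex Real MeasureTheory Set Filter
open scoped ComplexConjugate

namespace Literature.NumberTheory.LFunctions.Zhang2022.Typed.Sec14.U004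

open Skeleton

variable {D : ℕ}

/-! ## The `m`-series `Σ_m κ*(m)ψ(m)m^{−s}` on the line `σ = 3/2` -/

/-- For `Re s > 1` the series `Σ_m κ*(m)ψ(m)m^{−s}` (a `tsum`, as in `Typed.Sec14.i2Tilde`) is the
`LSeries` of `m ↦ [0 < m]κ*(m)ψ(m)` (the case `X = 0` of the tree's head/tail splitting).
[cite: Zhang2022LandauSiegel, §14 u003 p.76, tex L3854] -/
theorem tsum_twist_eq_LSeries (x : Chr D) {B : ℝ} {κs : ℕ → ℂ} (hκ : Eq141 B κs) {s : ℂ}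
    (hs : 1 < s.re) :
    ∑' m : ℕ, κs m * x.ψ (m : ZMod x.p) * (m : ℂ) ^ (-s) =
      LSeries (fun m : ℕ => if 0 < m then κs m * x.ψ (m : ZMod x.p) else 0) s := by
  rw [Eq143.tsum_twist_eq_head_add_LSeries x hκ 0 hs, show Finset.Icc 1 0 = ∅ by rfl,
    Finset.sum_empty, zero_add]

/-- **Continuity of `t ↦ Σ_m κ*(m)ψ(m)m^{−(3/2+it)}`** (the `m`-series is holomorphic on `Re s > 1`,
tree `Eq143.differentiableOn_LSeries_tail`). [cite: Zhang2022LandauSiegel, §14 u004 p.76, tex L3858] -/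
theorem continuous_twist_line (x : Chr D) {B : ℝ} {κs : ℕ → ℂ} (hκ : Eq141 B κs) :
    Continuous fun t : ℝ =>
      ∑' m : ℕ, κs m * x.ψ (m : ZMod x.p) * (m : ℂ) ^ (-((3 / 2 : ℂ) + t * I)) := by
  have hline : Continuous fun t : ℝ => (3 / 2 : ℂ) + (t : ℂ) * I := by fun_prop
  have hre : ∀ t : ℝ, ((3 / 2 : ℂ) + (t : ℂ) * I).re = 3 / 2 := fun t => by simp
  have hfun : (fun t : ℝ =>
      ∑' m : ℕ, κs m * x.ψ (m : ZMod x.p) * (m : ℂ) ^ (-((3 / 2 : ℂ) + t * I))) =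
      (LSeries fun m : ℕ => if 0 < m then κs m * x.ψ (m : ZMod x.p) else 0) ∘
        (fun t : ℝ => (3 / 2 : ℂ) + (t : ℂ) * I) := by
    ext t
    simp only [Function.comp_apply]
    exact tsum_twist_eq_LSeries x hκ (by rw [hre]; norm_num)
  rw [hfun]
  have hdiff := Eq143.differentiableOn_LSeries_tail x hκ 0
  have hmaps : ∀ t : ℝ, (3 / 2 : ℂ) + (t : ℂ) * I ∈ {s : ℂ | 1 < s.re} := fun t => by
    simp only [Set.mem_setOf_eq, hre]; norm_num
  exact hdiff.continuousOn.comp_continuous hline hmaps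

/-- **Size of the `m`-series on `σ = 3/2`**: `‖Σ_m κ*(m)ψ(m)m^{−s}‖ ≤ B·Σ_m τ₅(m)m^{−3/2}` for
`Re s = 3/2` (termwise `|κ*(m)ψ(m)m^{−s}| ≤ Bτ₅(m)m^{−3/2}`, tree `Eq143.norm_twist_term_le`).
[cite: Zhang2022LandauSiegel, §14 (14.1) p.76, tex L3828] -/
theorem norm_twist_tsum_le (x : Chr D) {B : ℝ} {κs : ℕ → ℂ} (hκ : Eq141 B κs) {s : ℂ}
    (hs : s.re = 3 / 2) :
    ‖∑' m : ℕ, κs m * x.ψ (m : ZMod x.p) * (m : ℂ) ^ (-s)‖ ≤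
      B * ∑' m : ℕ, MeanSquareMajorant.tau 5 m * (m : ℝ) ^ (-(3 / 2 : ℝ)) := by
  have hsum := Eq143.summable_tau_five_rpow (σ := 3 / 2) (by norm_num)
  have h := tsum_of_norm_bounded (hsum.mul_left B).hasSum fun m => by
    have h1 := Eq143.norm_twist_term_le x hκ s m
    rw [hs] at h1
    exact h1
  rwa [tsum_mul_left] at h

/-! ## The `a*`-polynomial and the modified integrand `G` on the line `σ = 3/2` -/

/-- Continuity of the `a*`-polynomial `t ↦ Σ_{n≤2P₄} a*(n)ψ̄(n)n^{(3/2+it)−1}` (a finite sum; tree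
`Eq143.differentiable_apoly`). [cite: Zhang2022LandauSiegel, §14 (14.2) p.76, tex L3831] -/
theorem continuous_apoly_line (x : Chr D) (as : ℕ → ℂ) :
    Continuous fun t : ℝ =>
      ∑ n ∈ Finset.Icc 1 ⌊2 * P4 D⌋₊, as n * conj (x.ψ (n : ZMod x.p)) *
        (n : ℂ) ^ (((3 / 2 : ℂ) + t * I) - 1) :=
  (Eq143.differentiable_apoly x as).continuous.comp
    (by fun_prop : Continuous fun t : ℝ => (3 / 2 : ℂ) + (t : ℂ) * I)

variable [NeZero D] (χ : DirichletCharacter ℂ D)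

/-- **Continuity of the modified integrand along `σ = 3/2`.**
[cite: Zhang2022LandauSiegel, §14 u004 p.76, tex L3858] -/
theorem continuous_lineIntegrand (x : Chr D) {B : ℝ} {κs : ℕ → ℂ} (hκ : Eq141 B κs)
    (as : ℕ → ℂ) :
    Continuous fun t : ℝ =>
      GammaFactor.tau (psiChi χ x)⁻¹ * ((D * x.p : ℕ) : ℂ) ^ (((3 / 2 : ℂ) + t * I) - 1) *
        GammaFactor.varthetaStarOneSub ((3 / 2 : ℂ) + t * I) *
        (∑' m : ℕ, κs m * x.ψ (m : ZMod x.p) * (m : ℂ) ^ (-((3 / 2 : ℂ) + t * I))) *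
        (∑ n ∈ Finset.Icc 1 ⌊2 * P4 D⌋₊, as n * conj (x.ψ (n : ZMod x.p)) *
          (n : ℂ) ^ (((3 / 2 : ℂ) + t * I) - 1)) *
        omegaW D ((3 / 2 : ℂ) + t * I) := by
  have hk0 : 0 < D * x.p := Nat.mul_pos (Nat.pos_of_ne_zero (NeZero.ne D)) x.prime.pos
  have hp : Continuous fun t : ℝ => ((D * x.p : ℕ) : ℂ) ^ (((3 / 2 : ℂ) + (t : ℂ) * I) - 1) := by
    refine Continuous.cpow continuous_const (by fun_prop) fun t => Or.inl ?_
    exact_mod_cast hk0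
  exact ((((continuous_const.mul hp).mul Section7I1Kernel.continuous_varthetaStar).mul
    (continuous_twist_line x hκ)).mul (continuous_apoly_line x as)).mul
    (Section7I1Kernel.continuous_omega_line D)

/-- **"A trivial bound for `ϑ*(1−s)ω(s)` on `σ = 3/2`", made explicit for `Ĩ₂(ψ)`**: for `D ≥ 3`,
`χ` primitive, `ψ (mod p) ∈ Ψ`, `|κ*| ≤ Bτ₅`, `|a*| ≤ B` and every real `t`, the modified integrand
`G(3/2+it) = τ((ψχ)‾)(Dp)^{s−1}ϑ*(1−s)(Σ_m κ*(m)ψ(m)m^{−s})(Σ_n a*(n)ψ̄(n)n^{s−1})ω(s)` satisfies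
`‖G(3/2+it)‖ ≤ K·(1+|t|)²·exp((1 − (t−2πt₀)²)/(4𝓛₂²))` with
`K = 16π²S·B²·(Dp)·⌊2P₄⌋^{3/2}·(√π/𝓛₂)`, `S = Σ_m τ₅(m)m^{−3/2}`
(`|τ((ψχ)‾)| = √(Dp)` as `ψχ` is primitive mod `Dp`, `|(Dp)^{s−1}| = √(Dp)`, the tree's
`Section7I1Line.norm_varthetaStar_le`, `norm_twist_tsum_le`, `Eq143.norm_apoly_le_pow`, and
`|ω(3/2+it)|` EXACT from `SmoothWeight.norm_omega_eq`).
[cite: Zhang2022LandauSiegel, §14 u004 p.76, tex L3858] -/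
theorem norm_lineIntegrand_le (hD : 3 ≤ D) (hχ : χ.IsPrimitive) (x : Chr D) {B : ℝ}
    {κs as : ℕ → ℂ} (hκ : Eq141 B κs) (ha : ∀ n, ‖as n‖ ≤ B) (hℓ₂ : 0 < ell2 D) (t : ℝ) :
    ‖GammaFactor.tau (psiChi χ x)⁻¹ * ((D * x.p : ℕ) : ℂ) ^ (((3 / 2 : ℂ) + t * I) - 1) *
        GammaFactor.varthetaStarOneSub ((3 / 2 : ℂ) + t * I) *
        (∑' m : ℕ, κs m * x.ψ (m : ZMod x.p) * (m : ℂ) ^ (-((3 / 2 : ℂ) + t * I))) *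
        (∑ n ∈ Finset.Icc 1 ⌊2 * P4 D⌋₊, as n * conj (x.ψ (n : ZMod x.p)) *
          (n : ℂ) ^ (((3 / 2 : ℂ) + t * I) - 1)) *
        omegaW D ((3 / 2 : ℂ) + t * I)‖ ≤
      (16 * π ^ 2 * (∑' m : ℕ, MeanSquareMajorant.tau 5 m * (m : ℝ) ^ (-(3 / 2 : ℝ))) * B ^ 2 *
          ((D * x.p : ℕ) : ℝ) * (⌊2 * P4 D⌋₊ : ℝ) ^ (3 / 2 : ℝ) * (Real.sqrt π / ell2 D)) *
        (1 + |t|) ^ 2 * Real.exp ((1 - (t - 2 * π * t0 D) ^ 2) / (4 * ell2 D ^ 2)) := by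
  have hB : 0 ≤ B := (norm_nonneg _).trans (ha 0)
  have hprim : (psiChi χ x).IsPrimitive := psiChiPrimitive_holds D χ x hD hχ
  have hk0 : 0 < D * x.p := Nat.mul_pos (Nat.pos_of_ne_zero (NeZero.ne D)) x.prime.pos
  have hk0' : (0 : ℝ) ≤ ((D * x.p : ℕ) : ℝ) := Nat.cast_nonneg _
  set s : ℂ := (3 / 2 : ℂ) + (t : ℂ) * I with hs
  have hre : s.re = 3 / 2 := by simp [hs]
  have him : s.im = t := by simp [hs]
  set S : ℝ := ∑' m : ℕ, MeanSquareMajorant.tau 5 m * (m : ℝ) ^ (-(3 / 2 : ℝ)) with hS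
  have hS0 : 0 ≤ S := tsum_nonneg fun m => mul_nonneg (MeanSquareMajorant.tau_nonneg 5 m)
    (Real.rpow_nonneg (Nat.cast_nonneg m) _)
  -- the six factors
  have hτ : ‖GammaFactor.tau (psiChi χ x)⁻¹‖ = Real.sqrt ((D * x.p : ℕ) : ℝ) := by
    have h := Sieve.LargeSieve.norm_gaussSum_sq (Sieve.LargeSieve.isPrimitive_inv hprim)
    rw [← Real.sqrt_sq (norm_nonneg (gaussSum (psiChi χ x)⁻¹ (ZMod.stdAddChar (N := D * x.p)))),
      h]
  have hp : ‖((D * x.p : ℕ) : ℂ) ^ (s - 1)‖ = Real.sqrt ((D * x.p : ℕ) : ℝ) := by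
    rw [Complex.norm_natCast_cpow_of_pos hk0, Real.sqrt_eq_rpow]
    congr 1
    rw [Complex.sub_re, hre, Complex.one_re]; norm_num
  have hθ := Section7I1Line.norm_varthetaStar_le t
  have hM := norm_twist_tsum_le x hκ (s := s) hre
  have hA : ‖∑ n ∈ Finset.Icc 1 ⌊2 * P4 D⌋₊, as n * conj (x.ψ (n : ZMod x.p)) *
      (n : ℂ) ^ (s - 1)‖ ≤ B * (⌊2 * P4 D⌋₊ : ℝ) ^ (3 / 2 : ℝ) := by
    have h := Eq143.norm_apoly_le_pow x ha (s := s) (by rw [hre]; norm_num)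
    rwa [hre] at h
  have hω : ‖omegaW D s‖ =
      Real.sqrt π / ell2 D * Real.exp ((1 - (t - 2 * π * t0 D) ^ 2) / (4 * ell2 D ^ 2)) := by
    rw [omegaW, SmoothWeight.norm_omega_eq hℓ₂, hre, him]
    norm_num
  have hsqrt : Real.sqrt ((D * x.p : ℕ) : ℝ) * Real.sqrt ((D * x.p : ℕ) : ℝ) = ((D * x.p : ℕ) : ℝ) :=
    Real.mul_self_sqrt hk0'
  have hN0 : 0 ≤ (⌊2 * P4 D⌋₊ : ℝ) ^ (3 / 2 : ℝ) := Real.rpow_nonneg (Nat.cast_nonneg _) _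
  have hE : 0 ≤ Real.exp ((1 - (t - 2 * π * t0 D) ^ 2) / (4 * ell2 D ^ 2)) := (Real.exp_pos _).le
  have hω0 : 0 ≤ Real.sqrt π / ell2 D := div_nonneg (Real.sqrt_nonneg _) hℓ₂.le
  calc ‖GammaFactor.tau (psiChi χ x)⁻¹ * ((D * x.p : ℕ) : ℂ) ^ (s - 1) *
        GammaFactor.varthetaStarOneSub s *
        (∑' m : ℕ, κs m * x.ψ (m : ZMod x.p) * (m : ℂ) ^ (-s)) *
        (∑ n ∈ Finset.Icc 1 ⌊2 * P4 D⌋₊, as n * conj (x.ψ (n : ZMod x.p)) * (n : ℂ) ^ (s - 1)) *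
        omegaW D s‖
      = ‖GammaFactor.tau (psiChi χ x)⁻¹‖ * ‖((D * x.p : ℕ) : ℂ) ^ (s - 1)‖ *
          ‖GammaFactor.varthetaStarOneSub s‖ *
          ‖∑' m : ℕ, κs m * x.ψ (m : ZMod x.p) * (m : ℂ) ^ (-s)‖ *
          ‖∑ n ∈ Finset.Icc 1 ⌊2 * P4 D⌋₊, as n * conj (x.ψ (n : ZMod x.p)) *
            (n : ℂ) ^ (s - 1)‖ * ‖omegaW D s‖ := by simp only [norm_mul]
    _ ≤ Real.sqrt ((D * x.p : ℕ) : ℝ) * Real.sqrt ((D * x.p : ℕ) : ℝ) *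
          (16 * π ^ 2 * (1 + |t|) ^ 2) * (B * S) * (B * (⌊2 * P4 D⌋₊ : ℝ) ^ (3 / 2 : ℝ)) *
          (Real.sqrt π / ell2 D * Real.exp ((1 - (t - 2 * π * t0 D) ^ 2) / (4 * ell2 D ^ 2))) := by
        rw [hτ, hp, hω]
        gcongr
    _ = (16 * π ^ 2 * S * B ^ 2 * ((D * x.p : ℕ) : ℝ) * (⌊2 * P4 D⌋₊ : ℝ) ^ (3 / 2 : ℝ) *
          (Real.sqrt π / ell2 D)) * (1 + |t|) ^ 2 *
          Real.exp ((1 - (t - 2 * π * t0 D) ^ 2) / (4 * ell2 D ^ 2)) := by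
        rw [hsqrt]; ring

/-- **A Gaussian majorant for the modified integrand** (for `D ≥ 9`, `χ` primitive, every real `t`):
`‖G(3/2+it)‖ ≤ K·e·144𝓛¹⁰³⁸·exp(−(t−2πt₀)²/(8𝓛₂²))`, `K` as in `norm_lineIntegrand_le` (the
polynomial factor against half of the Gaussian is the tree's `Section7I1Line.poly_gauss_le`).
[cite: Zhang2022LandauSiegel, §14 u004 p.76, tex L3858] -/
theorem norm_lineIntegrand_le_gauss (hD : 9 ≤ D) (hχ : χ.IsPrimitive) (x : Chr D) {B : ℝ}
    {κs as : ℕ → ℂ} (hκ : Eq141 B κs) (ha : ∀ n, ‖as n‖ ≤ B) (t : ℝ) :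
    ‖GammaFactor.tau (psiChi χ x)⁻¹ * ((D * x.p : ℕ) : ℂ) ^ (((3 / 2 : ℂ) + t * I) - 1) *
        GammaFactor.varthetaStarOneSub ((3 / 2 : ℂ) + t * I) *
        (∑' m : ℕ, κs m * x.ψ (m : ZMod x.p) * (m : ℂ) ^ (-((3 / 2 : ℂ) + t * I))) *
        (∑ n ∈ Finset.Icc 1 ⌊2 * P4 D⌋₊, as n * conj (x.ψ (n : ZMod x.p)) *
          (n : ℂ) ^ (((3 / 2 : ℂ) + t * I) - 1)) *
        omegaW D ((3 / 2 : ℂ) + t * I)‖ ≤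
      (16 * π ^ 2 * (∑' m : ℕ, MeanSquareMajorant.tau 5 m * (m : ℝ) ^ (-(3 / 2 : ℝ))) * B ^ 2 *
          ((D * x.p : ℕ) : ℝ) * (⌊2 * P4 D⌋₊ : ℝ) ^ (3 / 2 : ℝ) * (Real.sqrt π / ell2 D)) *
        (Real.exp 1 * (144 * ell D ^ 1038)) *
        Real.exp (-(1 / (8 * ell2 D ^ 2)) * (t - 2 * π * t0 D) ^ 2) := by
  have hD3 : 3 ≤ D := le_trans (by norm_num) hD
  have hℓ := Section6TailBounds.two_le_ell hD
  have hℓ0 : 0 < ell D := by linarith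
  have hℓ₂ : 0 < ell2 D := by rw [ell2]; positivity
  have hℓ₂1 : 1 ≤ ell2 D := by rw [ell2]; exact one_le_pow₀ (by linarith)
  have hB : 0 ≤ B := (norm_nonneg _).trans (ha 0)
  have h := norm_lineIntegrand_le χ hD3 hχ x hκ ha hℓ₂ t
  set K : ℝ := 16 * π ^ 2 * (∑' m : ℕ, MeanSquareMajorant.tau 5 m * (m : ℝ) ^ (-(3 / 2 : ℝ))) *
    B ^ 2 * ((D * x.p : ℕ) : ℝ) * (⌊2 * P4 D⌋₊ : ℝ) ^ (3 / 2 : ℝ) * (Real.sqrt π / ell2 D) with hK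
  have hS0 : 0 ≤ ∑' m : ℕ, MeanSquareMajorant.tau 5 m * (m : ℝ) ^ (-(3 / 2 : ℝ)) :=
    tsum_nonneg fun m => mul_nonneg (MeanSquareMajorant.tau_nonneg 5 m)
      (Real.rpow_nonneg (Nat.cast_nonneg m) _)
  have hK0 : 0 ≤ K := by
    rw [hK]
    have : 0 ≤ (⌊2 * P4 D⌋₊ : ℝ) ^ (3 / 2 : ℝ) := Real.rpow_nonneg (Nat.cast_nonneg _) _
    have : 0 ≤ Real.sqrt π / ell2 D := div_nonneg (Real.sqrt_nonneg _) hℓ₂.le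
    positivity
  -- split the exponential
  set u : ℝ := t - 2 * π * t0 D with hu
  have hsplit : Real.exp ((1 - u ^ 2) / (4 * ell2 D ^ 2)) =
      Real.exp (1 / (4 * ell2 D ^ 2)) * Real.exp (-(1 / (8 * ell2 D ^ 2)) * u ^ 2) *
        Real.exp (-(1 / (8 * ell2 D ^ 2)) * u ^ 2) := by
    rw [← Real.exp_add, ← Real.exp_add]
    congr 1
    field_simp
    ring
  have he1 : Real.exp (1 / (4 * ell2 D ^ 2)) ≤ Real.exp 1 := by
    apply Real.exp_le_exp.mpr
    rw [div_le_one (by positivity)]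
    nlinarith
  have hpg := Section7I1Line.poly_gauss_le hD t
  rw [← hu] at hpg
  have hE : 0 ≤ Real.exp (-(1 / (8 * ell2 D ^ 2)) * u ^ 2) := (Real.exp_pos _).le
  calc _ ≤ K * (1 + |t|) ^ 2 * Real.exp ((1 - u ^ 2) / (4 * ell2 D ^ 2)) := h
    _ = K * (Real.exp (1 / (4 * ell2 D ^ 2)) *
          ((1 + |t|) ^ 2 * Real.exp (-(1 / (8 * ell2 D ^ 2)) * u ^ 2))) *
          Real.exp (-(1 / (8 * ell2 D ^ 2)) * u ^ 2) := by rw [hsplit]; ring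
    _ ≤ K * (Real.exp 1 * (144 * ell D ^ 1038)) * Real.exp (-(1 / (8 * ell2 D ^ 2)) * u ^ 2) := by
        gcongr

/-- **Integrability of the modified integrand along `σ = 3/2`** (continuous, with the Gaussian
majorant `norm_lineIntegrand_le_gauss`), for `D ≥ 9` and `χ` primitive.
[cite: Zhang2022LandauSiegel, §14 u004 p.76, tex L3858] -/
theorem integrable_lineIntegrand (hD : 9 ≤ D) (hχ : χ.IsPrimitive) (x : Chr D) {B : ℝ}
    {κs as : ℕ → ℂ} (hκ : Eq141 B κs) (ha : ∀ n, ‖as n‖ ≤ B) :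
    Integrable fun t : ℝ =>
      GammaFactor.tau (psiChi χ x)⁻¹ * ((D * x.p : ℕ) : ℂ) ^ (((3 / 2 : ℂ) + t * I) - 1) *
        GammaFactor.varthetaStarOneSub ((3 / 2 : ℂ) + t * I) *
        (∑' m : ℕ, κs m * x.ψ (m : ZMod x.p) * (m : ℂ) ^ (-((3 / 2 : ℂ) + t * I))) *
        (∑ n ∈ Finset.Icc 1 ⌊2 * P4 D⌋₊, as n * conj (x.ψ (n : ZMod x.p)) *
          (n : ℂ) ^ (((3 / 2 : ℂ) + t * I) - 1)) *
        omegaW D ((3 / 2 : ℂ) + t * I) := by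
  have hℓ := Section6TailBounds.two_le_ell hD
  have hℓ₂ : 0 < ell2 D := by rw [ell2]; positivity
  have hb : 0 < 1 / (8 * ell2 D ^ 2) := by positivity
  have hg : Integrable fun t : ℝ =>
      (16 * π ^ 2 * (∑' m : ℕ, MeanSquareMajorant.tau 5 m * (m : ℝ) ^ (-(3 / 2 : ℝ))) * B ^ 2 *
          ((D * x.p : ℕ) : ℝ) * (⌊2 * P4 D⌋₊ : ℝ) ^ (3 / 2 : ℝ) * (Real.sqrt π / ell2 D)) *
        (Real.exp 1 * (144 * ell D ^ 1038)) *
        Real.exp (-(1 / (8 * ell2 D ^ 2)) * (t - 2 * π * t0 D) ^ 2) :=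
    ((integrable_exp_neg_mul_sq hb).comp_sub_right (2 * π * t0 D)).const_mul _
  exact hg.mono' (continuous_lineIntegrand χ x hκ as).aestronglyMeasurable
    (ae_of_all _ fun t => norm_lineIntegrand_le_gauss χ hD hχ x hκ ha t)

end Literature.NumberTheory.LFunctions.Zhang2022.Typed.Sec14.U004
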